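import Summits.QuantumFields.YangMills.Theorems.ParabolicTrajectoryLatticeGapOnTrajectoryTransferLimits
import HarnessLib

/-!
# Crux `LatticeGapOnTrajectory` (stmt-QuantumFields-10523), line `orbit-kantorovich-finite-size`:
# the transfer clause from a lattice gap in OS currency on the scheme's torus (A2)

Helper file (`--supports stmt-QuantumFields-10523`) for the registered stub `stub_transfer`, last of
the three files `Literature/…/SpeciesLatticeProducts`, `Literature/…/ReflectedCorrelationPolarisation`, `…TransferLimits`, this one. It makes the
repair recorded on the item (evidence `transfer-analysis.md`) machine-checked: the crux's transfer
clause `∀ sch' ~ sch, ∀ T, IsYangMillsFor r sch' T → T.HasMassGap Δ` follows from a lattice mass gap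
stated in Osterwalder–Schrader (variance-normalised) currency on the scheme's OWN torus —
`TorusOSGap r sch Δ` below — for every witness renormalisation that is time-reflection SYMMETRIC
(`SpeciesScheme.IsReflectionSymmetric`), with the SAME rate `Δ`:
`transferHalf_of_torusOSGap`.

* `TorusOSGap r sch Δ`: eventually in `k`, for every bounded measurable `X : (links of the torus of
  side `2L_k+1`) → ℂ` depending only on the links based at lattice times `1 … w`, and every time
  shift `m` with `m + 2w ≤ L_k`,
  `‖∫ conj X(Θ'U) X(τ_m U) dμ_k − |∫X dμ_k|²‖ ≤ Re(∫ conj X(Θ'U) X(U) dμ_k − |∫X dμ_k|²) · e^{−Δ a_k m}`,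
  `μ_k` Wilson's measure at `β_k`, `Θ'` the torus SITE time reflection `t ↦ −t`
  (`GaugeConfig.negReflect`), `τ_m` the torus time translation `(τ_m U)(x,i) = U(x + m e₀, i)`
  (`torusTimeShift`, the translation of `latticeConnectedCorr`: `torusLift_torusTimeShift`). This is the
  spectral statement "`T ≥ 0` and `σ(T) ∩ (e^{−aΔ}, 1) = ∅` on the OS space of the positive-time
  half-torus" in the only currency that survives the continuum limit (standing disproof, PROVER
  NOTE: constants must be OS norms, not sup norms).
* Proof of the bridge (`hasMassGap_of_torusOSGap`): the reduction `hasMassGap_of_dense_clustering`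
  (`…TransferReduction`) with `D n = span (slabOrderedProducts 4 n)` (dense among time-ordered test
  functions: `IsTimeOrdered.mem_closure_span_slabOrderedProducts`) and the `M`-adic rationals as
  times (`dense_MAdic`; an `M`-adic scheme reaches them exactly: `a_k s_k = q/M^{i}` for
  `s_k = q M^{n_k − i}`); for slab sums `F, G'` the truncated function
  `𝔖_{n+m}(ΘF* ⊗ T_t G') − 𝔖_n(ΘF*) 𝔖_m(G')` is the limit of the lattice quantity
  `osCorr μ_k Θ' τ_{s_k} (rep F) (rep G')` (`…TransferLimits`), which polarisation
  (`norm_osCorr_le_of_gap`, `ReflectedCorrelationPolarisation`) and `TorusOSGap` bound by `2 (osVar rep F + osVar rep G') e^{−Δt}`, and the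
  OS variances converge to the continuous functionals `C(F) = Re(𝔖_{2n}(ΘF* ⊗ F) − 𝔖_n(ΘF*) 𝔖_n(F))`
  of the test functions (labels: the reflected species string on the reflected side).

References: Osterwalder–Seiler 1978 §2; Glimm–Jaffe 1987 §6.1 and §19.7; the item's evidence
`transfer-analysis.md`; `Cruxes/LatticeGapOnTrajectory/Disproof.lean` (PROVER NOTE, §1 shape lemmas).
-/

open scoped SchwartzMap Topology ComplexConjugate
open Filter Set MeasureTheory
open Literature.MathematicalPhysics.AQFT Literature.MathematicalPhysics.QuantumLattice
open Literature.MathematicalPhysics.QuantumFieldTheory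

noncomputable section

namespace Summit.QuantumFields.YangMills.Cruxes.LatticeGapOnTrajectory.OrbitKantorovichFiniteSize

namespace Transfer

/-! ## §1 `M`-adic times and the shape of the scheme -/

/-- **The `M`-adic rationals `j / M^i` are dense in `ℝ`** (`M ≥ 2`). [folklore] -/
theorem dense_MAdic {M : ℕ} (hM : 2 ≤ M) : Dense {t : ℝ | ∃ (i : ℕ) (j : ℤ), t = j / (M : ℝ) ^ i} := by
  refine Metric.dense_iff.2 fun x ε hε => ?_
  obtain ⟨i, hi⟩ : ∃ i : ℕ, ((M : ℝ) ^ i)⁻¹ < ε := by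
    have h1 : (1 : ℝ) < M := by exact_mod_cast hM
    have h : Tendsto (fun i : ℕ => ((M : ℝ) ^ i)⁻¹) atTop (𝓝 0) :=
      tendsto_inv_atTop_zero.comp (tendsto_pow_atTop_atTop_of_one_lt h1)
    exact (h.eventually (gt_mem_nhds hε)).exists
  have hM0 : (0 : ℝ) < M := by exact_mod_cast lt_of_lt_of_le (by norm_num) hM
  have hpos : (0 : ℝ) < (M : ℝ) ^ i := pow_pos hM0 i
  refine ⟨(⌊x * (M : ℝ) ^ i⌋ : ℝ) / (M : ℝ) ^ i, ?_, i, ⌊x * (M : ℝ) ^ i⌋, rfl⟩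
  rw [Metric.mem_ball, Real.dist_eq]
  have h1 : (⌊x * (M : ℝ) ^ i⌋ : ℝ) / (M : ℝ) ^ i - x = -Int.fract (x * (M : ℝ) ^ i) / (M : ℝ) ^ i := by
    rw [Int.fract]
    field_simp
    ring
  rw [h1, abs_div, abs_neg, abs_of_nonneg (Int.fract_nonneg _), abs_of_pos hpos]
  calc Int.fract (x * (M : ℝ) ^ i) / (M : ℝ) ^ i < 1 / (M : ℝ) ^ i :=
        div_lt_div_of_pos_right (Int.fract_lt_one _) hpos
    _ = ((M : ℝ) ^ i)⁻¹ := one_div _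
    _ < ε := hi

/-- Under the shape `a_k = M^{-n_k}` the inverse spacing `M^{n_k}` tends to infinity. [folklore] -/
theorem tendsto_natPow_of_shape {ι : Type} (sch : SpeciesScheme ι) {M : ℕ} {n : ℕ → ℕ}
    (h : ∀ k, sch.a k = ((M : ℝ) ^ n k)⁻¹) : Tendsto (fun k => (M : ℝ) ^ n k) atTop atTop := by
  -- adapted from `Cruxes/LatticeGapOnTrajectory/Disproof.lean` §1 (`tendsto_natPow_of_shape`)
  have hpos : Tendsto sch.a atTop (𝓝[>] (0 : ℝ)) :=
    tendsto_nhdsWithin_iff.2 ⟨sch.tendsto_a, Eventually.of_forall fun k => sch.a_pos k⟩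
  refine (tendsto_inv_nhdsGT_zero.comp hpos).congr fun k => ?_
  rw [Function.comp_apply, h k, inv_inv]

/-- Under the shape `a_k = M^{-n_k}`, `M ≥ 2`, the exponents `n_k` tend to infinity. [folklore] -/
theorem tendsto_n_of_shape {ι : Type} (sch : SpeciesScheme ι) {M : ℕ} (hM : 2 ≤ M) {n : ℕ → ℕ}
    (h : ∀ k, sch.a k = ((M : ℝ) ^ n k)⁻¹) : Tendsto n atTop atTop := by
  -- adapted from `Cruxes/LatticeGapOnTrajectory/Disproof.lean` §1 (`tendsto_n_of_shape`)
  have hpow := tendsto_natPow_of_shape sch h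
  rw [tendsto_atTop_atTop] at hpow ⊢
  intro N
  obtain ⟨K, hK⟩ := hpow ((M : ℝ) ^ N + 1)
  refine ⟨K, fun k hk => ?_⟩
  by_contra hlt
  push Not at hlt
  have h1 : (1 : ℝ) ≤ M := by exact_mod_cast (by omega : 1 ≤ M)
  have hle : (M : ℝ) ^ n k ≤ (M : ℝ) ^ N := pow_le_pow_right₀ h1 hlt.le
  linarith [hK k hk]

/-! ## §2 The lattice gap in OS currency on the scheme's torus -/

variable {G : Type} [Group G] [TopologicalSpace G] [IsTopologicalGroup G] [CompactSpace G]
  [MeasurableSpace G] [BorelSpace G]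

/-- **Lattice mass gap `Δ` in Osterwalder–Schrader currency on the scheme's own torus.**
Eventually in `k`: for every bounded measurable `X` on the configurations of the torus of side
`2L_k + 1` depending only on the links based at lattice times `1, …, w`, and every `m` with
`m + 2w ≤ L_k`,
`‖∫ conj X(Θ'U) · X(τ_m U) dμ_k − conj(∫X) ∫X‖ ≤ Re(∫ conj X(Θ'U) · X(U) dμ_k − conj(∫X) ∫X) · e^{−Δ a_k m}`
where `μ_k = wilsonMeasure r.ρ β_k`, `Θ' = GaugeConfig.negReflect` is the torus SITE time reflection
`t ↦ −t` (`SpeciesTimeReflection`) and `τ_m = torusTimeShift _ m`, `(τ_m U)(x, i) = U(x + m e₀, i)`, is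
the time translation of `latticeConnectedCorr` (`torusLift_torusTimeShift`). Transfer-matrix reading:
`⟨Ψ_X, (T^m − |Ω⟩⟨Ω|) Ψ_X⟩ ≤ ‖Ψ_X − ⟨Ω,Ψ_X⟩Ω‖² e^{−aΔm}` on the OS space of the positive half-torus —
the lattice Hamiltonian has no spectrum in `(0, Δ)` in physical units, in the variance-normalised
form that survives `a_k → 0` (a HYPOTHESIS of the bridge; reflection positivity itself is not used).
[cite: OsterwalderSeiler1978, §2] [cite: GlimmJaffe1987, §6.1 and §19.7] -/
def TorusOSGap (r : LatticeRep G) (sch : SpeciesScheme (YMSpecies G)) (Δ : ℝ) : Prop :=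
  ∃ k₀ : ℕ, ∀ k ≥ k₀, ∀ (w m : ℕ) (X : GaugeConfig 4 (sch.side k) G → ℂ), Measurable X →
    (∃ B, ∀ U, ‖X U‖ ≤ B) →
    DependsOn X {e : Edge 4 (sch.side k) | 1 ≤ (e.1 0).val ∧ (e.1 0).val ≤ w} →
    m + 2 * w ≤ sch.L k →
      ‖(∫ U, conj (X U.negReflect) * X (torusTimeShift (sch.side k) m U) ∂(wilsonMeasure r.ρ (sch.β k))) -
          conj (∫ U, X U ∂(wilsonMeasure r.ρ (sch.β k))) *
            ∫ U, X U ∂(wilsonMeasure r.ρ (sch.β k))‖ ≤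
        ((∫ U, conj (X U.negReflect) * X U ∂(wilsonMeasure r.ρ (sch.β k))) -
            conj (∫ U, X U ∂(wilsonMeasure r.ρ (sch.β k))) *
              ∫ U, X U ∂(wilsonMeasure r.ρ (sch.β k))).re *
          Real.exp (-Δ * sch.a k * m)

/-! ## §3 Limits of the lattice correlations of representatives; the bridge -/

omit [Group G] [TopologicalSpace G] [IsTopologicalGroup G] [CompactSpace G] [BorelSpace G] in
/-- `τ_0 = id` as functions. [folklore] -/
theorem coe_torusTimeShift_zero (Sd : ℕ) : ⇑(torusTimeShift (G := G) Sd 0) = id :=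
  funext (torusTimeShift_zero_apply Sd)

/-- A uniform positive lower slab time of slab-sum data. [folklore] -/
theorem exists_pos_le_lo {n : ℕ} (D : SlabSum n) : ∃ lo₀ : ℝ, 0 < lo₀ ∧ ∀ i j, lo₀ ≤ D.lo i j := by
  by_cases h : Nonempty (Fin D.N × Fin n)
  · obtain ⟨p, hp⟩ := Finite.exists_min fun p : Fin D.N × Fin n => D.lo p.1 p.2
    exact ⟨D.lo p.1 p.2, D.lo_pos _ _, fun i j => hp (i, j)⟩
  · exact ⟨1, one_pos, fun i j => (h ⟨(i, j)⟩).elim⟩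

/-- A uniform nonnegative upper slab time of slab-sum data. [folklore] -/
theorem exists_hi_le {n : ℕ} (D : SlabSum n) : ∃ hi₀ : ℝ, 0 ≤ hi₀ ∧ ∀ i j, D.hi i j ≤ hi₀ := by
  by_cases h : Nonempty (Fin D.N × Fin n)
  · obtain ⟨p, hp⟩ := Finite.exists_max fun p : Fin D.N × Fin n => D.hi p.1 p.2
    exact ⟨max 0 (D.hi p.1 p.2), le_max_left _ _, fun i j => (hp (i, j)).trans (le_max_right _ _)⟩
  · exact ⟨0, le_rfl, fun i j => (h ⟨(i, j)⟩).elim⟩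

variable (r : LatticeRep G) {S : SpeciesScheme (YMSpecies G)} {T : OSData (YMSpecies G) 4}

/-- **Limit of the reflected translated correlation of representatives**:
`osCorr μ_k Θ' τ_{s_k} (rep F) (rep G') → 𝔖_{n+m}^{Θσ∘rev ++ σ'}(ΘF* ⊗ T_t G') − 𝔖_n^{Θσ∘rev}(ΘF*) 𝔖_m^{σ'}(G')`. [cite: OsterwalderSeiler1978, §2] -/
theorem tendsto_osCorr_rep (hT : IsYangMillsFor r S T) (hsym : S.IsReflectionSymmetric) {n m : ℕ}
    (D : SlabSum n) (D' : SlabSum m) (σ : Fin n → YMSpecies G) (σ' : Fin m → YMSpecies G)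
    {t : ℝ} (ht : 0 ≤ t) {s : ℕ → ℕ} (hs : ∀ᶠ k in atTop, S.a k * (s k : ℝ) = t) :
    Tendsto (fun k => osCorr (wilsonMeasure r.ρ (S.β k)) GaugeConfig.negReflect
        (torusTimeShift (S.side k) (s k)) (D.rep S σ k) (D'.rep S σ' k)) atTop
      (𝓝 (T.schwinger (n + m) (Fin.append ((fun i => (σ i).timeReflect) ∘ Fin.rev) σ')
          ((osAdjoint D.sum).appendTensor (translateMulti (EuclideanSpace.single 0 t) D'.sum)) -
        T.schwinger n ((fun i => (σ i).timeReflect) ∘ Fin.rev) (osAdjoint D.sum) *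
          T.schwinger m σ' D'.sum)) :=
  (tendsto_integral_conj_rep_mul_rep r hT hsym D D' σ σ' ht hs).sub
    ((tendsto_conj_integral_rep r hT hsym D σ).mul (tendsto_integral_rep r hT D' σ'))

/-- **Limit of the OS variance of a representative**:
`osVar μ_k Θ' (rep F) → Re(𝔖_{2n}^{Θσ∘rev ++ σ}(ΘF* ⊗ F) − 𝔖_n^{Θσ∘rev}(ΘF*) 𝔖_n^{σ}(F))`. [cite: OsterwalderSeiler1978, §2] -/
theorem tendsto_osVar_rep (hT : IsYangMillsFor r S T) (hsym : S.IsReflectionSymmetric) {n : ℕ}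
    (D : SlabSum n) (σ : Fin n → YMSpecies G) :
    Tendsto (fun k => osVar (wilsonMeasure r.ρ (S.β k)) GaugeConfig.negReflect (D.rep S σ k)) atTop
      (𝓝 ((T.schwinger (n + n) (Fin.append ((fun i => (σ i).timeReflect) ∘ Fin.rev) σ)
          ((osAdjoint D.sum).appendTensor D.sum) -
        T.schwinger n ((fun i => (σ i).timeReflect) ∘ Fin.rev) (osAdjoint D.sum) *
          T.schwinger n σ D.sum).re)) := by
  have h0 : (EuclideanSpace.single (0 : Fin 4) (0 : ℝ) : EuclideanSpace ℝ (Fin 4)) = 0 := by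
    ext i; simp
  have h := tendsto_osCorr_rep r hT hsym D D σ σ le_rfl (s := fun _ => 0)
    (Eventually.of_forall fun k => by simp)
  rw [h0, translateMulti_zero] at h
  simp only [coe_torusTimeShift_zero] at h
  exact (Complex.continuous_re.tendsto _).comp h

/-- **The bridge, one scheme.** For an `M`-adic scheme `S` (`a_k = M^{-n_k}`, `M ≥ 2`) with
reflection-symmetric renormalisations, `TorusOSGap r S Δ` implies `T.HasMassGap Δ` for every OS
datum `T` with `IsYangMillsFor r S T`: density reduction to slab sums and `M`-adic times; lattice
representatives; polarisation of the diagonal gap; limits of correlations and OS variances.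
[cite: GlimmJaffe1987, §6.1 and §19.7] [cite: OsterwalderSeiler1978, §2] -/
theorem hasMassGap_of_torusOSGap (r : LatticeRep G) {M : ℕ} {S : SpeciesScheme (YMSpecies G)}
    {n : ℕ → ℕ} {Δ : ℝ} (hM : 2 ≤ M) (hshape : ∀ k, S.a k = ((M : ℝ) ^ n k)⁻¹)
    (hgap : TorusOSGap r S Δ) (hsym : S.IsReflectionSymmetric) {T : OSData (YMSpecies G) 4}
    (hT : IsYangMillsFor r S T) : T.HasMassGap Δ := by
  have hV : ∀ (p : ℕ) (l₁ : Fin (p + p) → YMSpecies G) (l₂ l₃ : Fin p → YMSpecies G),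
      Continuous fun F : 𝓢((Fin p → EuclideanSpace ℝ (Fin 4)), ℂ) =>
        (T.schwinger (p + p) l₁ ((osAdjoint F).appendTensor F) -
          T.schwinger p l₂ (osAdjoint F) * T.schwinger p l₃ F).re := fun p l₁ l₂ l₃ =>
    Complex.continuous_re.comp ((((T.schwinger (p + p) l₁).continuous.comp
      (continuous_appendTensor.comp (continuous_osAdjoint.prodMk continuous_id))).sub
      (((T.schwinger p l₂).continuous.comp continuous_osAdjoint).mul (T.schwinger p l₃).continuous)))
  obtain ⟨k₀, hk₀⟩ := hgap
  refine hasMassGap_of_dense_clustering T Δ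
    (fun p => (Submodule.span ℂ (slabOrderedProducts 4 p) : Set _))
    (fun p F hF => hF.mem_closure_span_slabOrderedProducts) _ (dense_MAdic hM)
    (fun p q σ σ' F G' => 2 * ((T.schwinger (p + p) (Fin.append (σ ∘ Fin.rev)
        (fun i => (σ i).timeReflect)) ((osAdjoint F).appendTensor F) -
        T.schwinger p (σ ∘ Fin.rev) (osAdjoint F) * T.schwinger p (fun i => (σ i).timeReflect) F).re +
      (T.schwinger (q + q) (Fin.append ((fun j => (σ' j).timeReflect) ∘ Fin.rev) σ')
        ((osAdjoint G').appendTensor G') -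
        T.schwinger q ((fun j => (σ' j).timeReflect) ∘ Fin.rev) (osAdjoint G') *
          T.schwinger q σ' G').re))
    (fun p q σ σ' => continuous_const.mul (((hV p _ _ _).comp continuous_fst).add
      ((hV q _ _ _).comp continuous_snd)))
    (fun p q σ σ' F G' hF hG' t ht ht0 => ?_)
  obtain ⟨D, rfl⟩ := SlabSum.exists_of_mem_span hF
  obtain ⟨D', rfl⟩ := SlabSum.exists_of_mem_span hG'
  obtain ⟨i₀, j, rfl⟩ := ht
  have hM0 : (0 : ℝ) < M := by exact_mod_cast lt_of_lt_of_le (by norm_num) hM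
  have hMi : (0 : ℝ) < (M : ℝ) ^ i₀ := pow_pos hM0 i₀
  have hj : (0 : ℤ) ≤ j := by
    by_contra hneg
    push Not at hneg
    have : (j : ℝ) / (M : ℝ) ^ i₀ < 0 := div_neg_of_neg_of_pos (by exact_mod_cast hneg) hMi
    linarith
  obtain ⟨jn, rfl⟩ := Int.eq_ofNat_of_zero_le hj
  -- the lattice time shifts realising `t`
  have hs : ∀ᶠ k in atTop, S.a k * ((jn * M ^ (n k - i₀) : ℕ) : ℝ) = ((jn : ℤ) : ℝ) / (M : ℝ) ^ i₀ := by
    filter_upwards [(tendsto_n_of_shape S hM hshape).eventually_ge_atTop i₀] with k hk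
    rw [hshape k]
    push_cast
    rw [pow_sub₀ _ hM0.ne' hk]
    field_simp
  -- limits
  have hcorr := tendsto_osCorr_rep r hT hsym D D' (fun i => (σ i).timeReflect) σ' ht0 hs
  have hvarF := tendsto_osVar_rep r hT hsym D (fun i => (σ i).timeReflect)
  have hvarG := tendsto_osVar_rep r hT hsym D' σ'
  simp only [LocalGaugeObservable.timeReflect_timeReflect] at hcorr hvarF
  refine le_of_tendsto_of_tendsto ((continuous_norm.tendsto _).comp hcorr)
    (((hvarF.add hvarG).const_mul 2).mul_const _) ?_
  -- the eventual lattice bound: polarised `TorusOSGap`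
  obtain ⟨loF, hloF, hloF'⟩ := exists_pos_le_lo D
  obtain ⟨loG, hloG, hloG'⟩ := exists_pos_le_lo D'
  obtain ⟨hiF, hhiF, hhiF'⟩ := exists_hi_le D
  obtain ⟨hiG, hhiG, hhiG'⟩ := exists_hi_le D'
  set R : ℕ := (Finset.univ.sup fun i => timeRadius (σ i).timeReflect) ⊔
    (Finset.univ.sup fun j => timeRadius (σ' j)) with hR
  have hRF : ∀ i, timeRadius (σ i).timeReflect ≤ R := fun i =>
    (Finset.le_sup (f := fun i => timeRadius (σ i).timeReflect) (Finset.mem_univ i)).trans le_sup_left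
  have hRG : ∀ j, timeRadius (σ' j) ≤ R := fun j =>
    (Finset.le_sup (f := fun j => timeRadius (σ' j)) (Finset.mem_univ j)).trans le_sup_right
  set lo₀ := min loF loG with hlo₀
  set hi₀ := max hiF hiG with hhi₀
  set t : ℝ := ((jn : ℤ) : ℝ) / (M : ℝ) ^ i₀ with htdef
  have hlo₀pos : 0 < lo₀ := lt_min hloF hloG
  have e3 : ∀ᶠ k in atTop, S.a k ≤ lo₀ / (R + 1) :=
    S.tendsto_a.eventually_le_const (by positivity)
  have e4 : ∀ᶠ k in atTop, S.a k ≤ 1 := S.tendsto_a.eventually_le_const one_pos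
  have e5 : ∀ᶠ k in atTop, t + 2 * hi₀ + 2 * (R + 2) ≤ S.a k * S.L k :=
    S.tendsto_L.eventually_ge_atTop _
  filter_upwards [eventually_ge_atTop k₀, hs, e3, e4, e5] with k hk1 hk2 hk3 hk4 hk5
  have ha := S.a_pos k
  haveI := isProbabilityMeasure_wilsonMeasure (d := 4) (L := S.side k) r.ρ r.continuous (S.β k)
  -- the window `w` and the arithmetic
  set w : ℕ := ⌈hi₀ / S.a k⌉₊ + R with hw
  have hw1 : hi₀ + S.a k * R ≤ S.a k * w := by
    have h1 : hi₀ / S.a k ≤ ⌈hi₀ / S.a k⌉₊ := Nat.le_ceil _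
    rw [div_le_iff₀ ha] at h1
    simp only [hw, Nat.cast_add]
    nlinarith
  have hw2 : (w : ℝ) ≤ hi₀ / S.a k + 1 + R := by
    have h1 := Nat.ceil_lt_add_one (div_nonneg ((le_max_left _ _).trans' hhiF) ha.le : 0 ≤ hi₀ / S.a k)
    simp only [hw, Nat.cast_add]
    linarith
  have hsw : jn * M ^ (n k - i₀) + 2 * w ≤ S.L k := by
    have h1 : ((jn * M ^ (n k - i₀) : ℕ) : ℝ) = t / S.a k := by
      rw [eq_div_iff ha.ne', mul_comm, hk2]
    have h2 : t / S.a k + 2 * (hi₀ / S.a k + 1 + R) ≤ S.L k := by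
      refine le_of_mul_le_mul_left ?_ ha
      have h4 : S.a k * (t / S.a k + 2 * (hi₀ / S.a k + 1 + R)) =
          t + 2 * hi₀ + 2 * (S.a k * (1 + R)) := by
        field_simp
        ring
      rw [h4]
      nlinarith [mul_le_mul_of_nonneg_right hk4 (by positivity : (0 : ℝ) ≤ 1 + R)]
    have h3 : ((jn * M ^ (n k - i₀) : ℕ) : ℝ) + 2 * (w : ℝ) ≤ S.L k := by
      rw [h1]; linarith
    exact_mod_cast h3
  have hwside : w < S.side k := by
    simp only [SpeciesScheme.side]; omega
  have hlat : ∀ (m' : ℕ) (Z : GaugeConfig 4 (S.side k) G → ℂ), Measurable Z →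
      (∃ B, ∀ U, ‖Z U‖ ≤ B) →
      DependsOn Z {e : Edge 4 (S.side k) | 1 ≤ (e.1 0).val ∧ (e.1 0).val ≤ w} → m' + 2 * w ≤ S.L k →
      ‖osCorr (wilsonMeasure r.ρ (S.β k)) GaugeConfig.negReflect (torusTimeShift (S.side k) m') Z Z‖ ≤
        osVar (wilsonMeasure r.ρ (S.β k)) GaugeConfig.negReflect Z * Real.exp (-Δ * S.a k * m') :=
    fun m' Z hZ hbZ hdZ hm' => hk₀ k hk1 w m' Z hZ hbZ hdZ hm'
  refine norm_osCorr_le_of_gap (μ := wilsonMeasure r.ρ (S.β k))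
    (Good := fun Z => Measurable Z ∧ (∃ B, ∀ U, ‖Z U‖ ≤ B) ∧
      DependsOn Z {e : Edge 4 (S.side k) | 1 ≤ (e.1 0).val ∧ (e.1 0).val ≤ w})
    WilsonSiteRP.measurable_negReflect (torusTimeShift _ _).measurable (fun Z hZ => hZ.1)
    (fun Z hZ => hZ.2.1) (fun X Y c hX hY => ⟨hX.1.add (hY.1.const_smul c), ?_, ?_⟩)
    (Real.exp_pos _).le (fun Z hZ => ?_) (fun Z hZ => ?_) ⟨D.measurable_rep S _ k,
      D.exists_bound_rep S _ k, D.dependsOn_rep S _ k hRF (fun i j' => ?_) (fun i j' => ?_) hwside⟩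
    ⟨D'.measurable_rep S _ k, D'.exists_bound_rep S _ k,
      D'.dependsOn_rep S _ k hRG (fun i j' => ?_) (fun i j' => ?_) hwside⟩
  · obtain ⟨B, hB⟩ := hX.2.1
    obtain ⟨B', hB'⟩ := hY.2.1
    refine ⟨B + ‖c‖ * B', fun U => ?_⟩
    rw [Pi.add_apply, Pi.smul_apply, smul_eq_mul]
    exact (norm_add_le _ _).trans (add_le_add (hB U)
      (by rw [norm_mul]; exact mul_le_mul_of_nonneg_left (hB' U) (norm_nonneg _)))
  · intro U V hUV
    simp only [Pi.add_apply, Pi.smul_apply]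
    rw [hX.2.2 hUV, hY.2.2 hUV]
  · have h := hlat _ Z hZ.1 hZ.2.1 hZ.2.2 hsw
    rwa [mul_assoc, hk2] at h
  · have h := hlat 0 Z hZ.1 hZ.2.1 hZ.2.2 (by omega)
    simp only [Nat.cast_zero, mul_zero, Real.exp_zero, mul_one] at h
    exact (norm_nonneg _).trans h
  · have hk3' : S.a k * (R + 1) ≤ lo₀ := (le_div_iff₀ (by positivity)).1 hk3
    exact hk3'.trans ((min_le_left _ _).trans (hloF' i j'))
  · linarith [hhiF' i j', le_max_left hiF hiG]
  · have hk3' : S.a k * (R + 1) ≤ lo₀ := (le_div_iff₀ (by positivity)).1 hk3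
    exact hk3'.trans ((min_le_right _ _).trans (hloG' i j'))
  · linarith [hhiG' i j', le_max_right hiF hiG]

/-- **The transfer clause of the crux from a lattice gap in OS currency** (the repair of
`stub_transfer`, machine-checked): for the `M`-adic scheme `sch` of the crux (`a_k = M^{-n_k}`,
`M ≥ 2`) a torus OS gap `TorusOSGap r sch Δ` gives `T.HasMassGap Δ` — same rate — for EVERY scheme
`sch'` with the same spacings, couplings and volumes whose witness renormalisations are
time-reflection symmetric, and every OS datum `T` with `IsYangMillsFor r sch' T`. What does NOT
transfer is recorded in the disproof file: sup-norm constants (they pick up `c_A c_B ∼ a⁻⁸`) and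
asymmetric renormalisations (the reflected species then carry other constants). [cite: GlimmJaffe1987, §6.1 and §19.7] [cite: OsterwalderSeiler1978, §2] -/
theorem transferHalf_of_torusOSGap
    (r : LatticeRep G) (M : ℕ) (sch : SpeciesScheme (YMSpecies G)) (n : ℕ → ℕ) (Δ : ℝ)
    (hM : 2 ≤ M) (hshape : ∀ k, sch.a k = ((M : ℝ) ^ n k)⁻¹) (hgap : TorusOSGap r sch Δ) :
    ∀ sch' : SpeciesScheme (YMSpecies G), sch'.a = sch.a → sch'.β = sch.β → sch'.L = sch.L →
      sch'.IsReflectionSymmetric →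
        ∀ T : OSData (YMSpecies G) 4, IsYangMillsFor r sch' T → T.HasMassGap Δ := by
  intro sch' ha hβ hL hsym T hT
  obtain ⟨a', ha', hta', β', L', htL', c', m'⟩ := sch'
  have ha1 : a' = sch.a := ha
  have hβ1 : β' = sch.β := hβ
  have hL1 : L' = sch.L := hL
  subst ha1 hβ1 hL1
  exact hasMassGap_of_torusOSGap r hM (S := ⟨sch.a, ha', hta', sch.β, sch.L, htL', c', m'⟩) hshape
    hgap hsym hT

end Transfer

end Summit.QuantumFields.YangMills.Cruxes.LatticeGapOnTrajectory.OrbitKantorovichFiniteSize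

end
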